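import Literature.AlgebraicGeometry.ShimuraVarieties.KudlaRapoport2013.Sec3ComplexUniformization
import Mathlib.LinearAlgebra.QuadraticForm.Basic
import Mathlib.NumberTheory.NumberField.Discriminant.Defs
import Mathlib.AlgebraicGeometry.Morphisms.Smooth
import HarnessLib

/-!
# Kudla–Rapoport, *Special cycles on unitary Shimura varieties II: global theory*, §13 «Level structures»
# (arXiv v2 pp. 48–51) — SECTION CARPET (statements only, no proof)

[KudlaRapoport2013] = S. Kudla, M. Rapoport, *Special cycles on unitary Shimura varieties II: global theory*, J. reine
angew. Math. **697** (2014) 91–157 = arXiv:0912.3758.  VERSION OF RECORD (squad ruling R-1): arXiv **v2** (18 Dec 2012),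
cited «(arXiv v2 p. N)», read on the squad's v2 page text (`T/KR/TKR-t02/g0/KR2013-arXivv2-pages.txt`, sha16
5ca9342435eb98df) with formulas from the held v1 TeX (`paper:arxiv-0912.3758`, chunks p0034–p0035).  CONCORDANCE v1 ↔ v2
for §13: identical numbering and wording — Prop. 13.1, Def. 13.2, Prop. 13.3, Rem. 13.4 (§13.1), Def. 13.5, Rem. 13.6,
Rem. 13.7 (§13.2); v1 pp. 61–64, v2 pp. 48–51; the only delta is v2's added sentence «If `S` is not connected, we require
these conditions on each connected component» in the definition of `Z(T)*` (p. 49).  (Items Def. 13.2 and Rem. 13.6 are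
missed by head-regex item maps; confirmed on the v2 text, lit6's items file bb9659efaa1451e6.)

## What this file is

The squad-TKR carpet of §13 (deal sheet `SPLIT-TKR.v1` row TKR-t03), built on the §3 carpet `Sec3ComplexUniformization`
(hermitian lattices in coordinates `V = kⁿ` with Gram matrix `J`, KR's form `krForm`, `D(L) = negPlanes`, transport by
`GL_n(k)`, «isomorphism of orbifolds» = `IsGroupoidEquivOfAction`; READINGS R0–R3 there).  §13 defines VARIANTS of the
moduli problems of §2 (parahoric level `M(k, t; n−r, r)*` at ramified primes, §13.1; level-`N` structures `M(k; n−r, r)_{(N)}`,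
`M_{(N),K̄}`, `M_K`, `Z(T, ω)` at unramified primes, §13.2).  The moduli problems themselves are conditions on triples
`(A, ι, λ)` over `O_k`-schemes — the squad's `KudlaRapoport2013.Sec2Defs` object carriers (TKR-t01), not re-declared here;
this file types (i) the ARITHMETIC of §13 over REAL objects — the type function `t`, Definition 13.2 (lattices of type `t`),
the finite-field lemma behind the existence of type-`t` lattices, `𝓛_{(n−r,r)}(k, t)`, the standard hermitian form on
`(O_k/N O_k)ⁿ` of Definition 13.5 and the reduction `L/NL ≅ (O_k/N O_k)ⁿ`, the group `GU((O_k/N O_k)ⁿ)` and the flag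
stabiliser of Remark 13.6 (via the squad's ★ `Sec4RelationToShimuraVarieties.GU`) — and (ii) the GEOMETRIC statements
(Prop. 13.1, the `DM stack ∕ smooth ∕ scheme` sentences, Prop. 13.3) as PREDICATES on ⟨CARRIER⟩ data the consumer supplies
for its own models: the groupoid of complex points of `M(k, t; n−r, r)*` (Prop. 13.3, REAL right-hand side), a scheme model
of `M(k; n−r, r)_{(N)}` for `N ≥ 3` (Mathlib `SmoothOfRelativeDimension`), and — where Lean has no vocabulary (Cohen–Macaulay,
isolated rational singularities, semi-stable reduction of a DM stack) — `Prop`-valued ⟨CARRIER⟩ fields quoting the print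
(PLACEHOLDERS, declared as such; no closed fact reduces to them).  Dedup census (2026-09-02): no tree declaration carries a
`[cite: KudlaRapoport2013, §13 …]` tag.

Every `def … : Prop` named `KR2013_13_…` is either CLOSED (true as written), or a PREDICATE on consumer data (`∀ D, P D` is
never claimed), or — ED. 2, squad ruling R-10 — a REMARK-STATEMENT: the literal reading of a printed Remark asserted in loc.
cit. without proof and NOT certified here (`KR2013_13_4` only; do not consume).  NO PROOF, no `sorry`, no `axiom`, no
`instance`, no `notation`.

## INDEX — every item of §13 ↦ declaration

* §13 preamble (p. 48: «variants of our moduli problem `M(k; n−r, r)`») ↦ `Sec13Data` (extends the §3 datum by `t`).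
* §13.1 (pp. 48–49): the type `t` («for every `p ∣ Δ` an even integer `t(p)` with `0 ≤ t(p) ≤ n`») ↦ `Sec13Data.t`,
  `t_even`, `t_le`; `Δ` ↦ `absDisc`; «height of `ker λ` equal to `∏_{p∣Δ} p^{t(p)}`» ↦ `typeHeight`; the stack
  `M(k, t; n−r, r)^{*,naive}` and its conditions on `ker λ` (`ker λ ⊆ A[Δ]`, `O_k/(Δ)` acts through `∏_{p∣Δ} 𝔽_p`, height), the
  sentence «DM stack … smooth of relative dimension `(n−r)r` over `Spec O_k[Δ⁻¹]` … not flat in general», `M* :=` flat closure,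
  `Z(T)*` ↦ RECORDED (module level: conditions on the §2 object carrier; no new arithmetic) and ⟨CARRIER⟩ `Sec13Data.MstarC`;
  **Proposition 13.1** ↦ `KR2013_13_1` (predicate on ⟨CARRIER⟩ `StarModelFacts`); **Definition 13.2** ↦ `dualSet`, `IsOfType`;
  «an `O_k`-module of type `t = 0` is a self-dual hermitian `O_k`-module» ↦ `KR2013_13_2_typeZero` (CLOSED); «for any
  `O_k`-module of type `t`, `V = L ⊗ ℚ` is relevant» ↦ `KR2013_13_2_relevant` (CLOSED); «lattices of type `t` always exist …
  except …» + its local proof ↦ `KR2013_13_2_isotropic` (CLOSED: the finite-field clause «such subspaces always exist» for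
  `t(p) < n`; the exceptional clause `t(p) = n` ⇔ `inv_p(V) = 1` RECORDED — no Hilbert symbol in the tree);
  `𝓛_{(n−r,r)}(k, t)` ↦ `IsTypeTHermLattice`; **Proposition 13.3** ↦ `KR2013_13_3` (predicate; `TypedLatticePoint`);
  **Remark 13.4** ↦ `KR2013_13_4` (REMARK-STATEMENT, ED. 2: the literal class-set reading «either empty or in bijective
  correspondence with `𝓛_{(n−r,r)}(k)`, provided `2 ∤ Δ`» is NOT certified and is doubtful — QA-R6-1 below; certified content of
  KR's «remarks above» = `KR2013_13_2_isotropic`, `KR2013_13_2_relevant`; do not consume).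
* §13.2 (pp. 50–51): **Definition 13.5** ↦ `stdHermMatrix` (the standard form `h(e_i, e_{n−j+1}) = δ_{ij}`), ⟨CARRIER⟩
  `LevelNData.IsLevelNStructure` with `KR2013_13_5` (predicate: the printed definition's REAL clauses — `N` odd, prime to `Δ`,
  invertible on `S`), «if `L` is a self-dual `O_k`-module, then `L/NL` is isomorphic to `(O_k/N O_k)ⁿ` with the standard form» ↦
  `KR2013_13_5_reduction` (CLOSED); «`M(k; n−r, r)_{(N)}` … smooth of relative dimension `(n−r)r` over `Spec O_k[(NΔ)⁻¹]` … if
  `N ≥ 3` … a scheme» ↦ `KR2013_13_5_model` (predicate on a ⟨CARRIER⟩ scheme model, Mathlib `SmoothOfRelativeDimension`);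
  **Remark 13.6** ↦ `levelGroupModN` (`GU((O_k/N O_k)ⁿ)`), `stdFlagStabilizer`, `KR2013_13_6` (predicate); the adelic variants
  (`ℚ_N`, `ℤ_N`, `Γ(1) = GU(O_kⁿ ⊗ ℤ_N)`, `Γ(N)`-, `K`-level structures), `Z(T, ω)` and the sentence «if `K₀` and `K` are trivial …
  `Z(T, ω)` is equal to the previously defined stack `Z(T)`» ↦ RECORDED (module level; definitions of further moduli problems on
  the §2 carriers); **Remark 13.7** (mixing both level structures; «We expect that the results … can be extended … one has to
  assume `Diff₀(T) = {p}`, `p ∤ N` odd») ↦ RECORDED: an expectation, not a result.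

## ED. 2 (2026-09-02; QA box T-ref6 QA-R6-1, squad ruling R-10 «remarks as facts»)

The only change with respect to ED. 1 (★ p848266) is the banner of `KR2013_13_4` (name and body kept, no consumer exists):
Remark 13.4 is printed «by our remarks above» without proof, and those remarks (p. 49) establish only the LOCAL
correspondence type-`t` lattices `L_p` ↔ totally isotropic `t(p)/2`-subspaces of `Λ/πΛ` up to `U(V_p)` (typed as
`KR2013_13_2_isotropic`) plus existence; the literal GLOBAL class-set statement typed in ED. 1 as a CLOSED fact could not be
certified by the QA box and a standard class-number count makes it doubtful: for `k = ℚ(√−15)` (`Δ = −15`, `2 ∤ Δ`),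
`n = 2`, `r = 1`, `t(3) = 2`, `t(5) = 0`, strong approximation for `SU(V)` (indefinite case) gives `|𝓛_{(1,1)}(k)| = 2h¹` (two
relevant planes, one self-dual genus each, Lemma 2.11 / Cor. 2.16) but `|𝓛_{(1,1)}(k, t)| = h¹ ≠ 0` (type-`t` lattices with
`t(3) = n` live in one space only), so neither disjunct of the literal reading would hold (T-ref6, squad bus 2026-09-02
02:57:06Z, «modulo two textbook inputs: Jacobowitz at odd ramified `p`; Shimura's class-number formula for indefinite unitary
genera»).  Hence `KR2013_13_4` is re-bannered REMARK-STATEMENT: recorded as printed, literal reading NOT certified, not to be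
consumed as a hypothesis; it is not counted among this file's certified CLOSED facts (`KR2013_13_2_typeZero`,
`KR2013_13_2_relevant`, `KR2013_13_2_isotropic`, `KR2013_13_5_reduction`).

## References

* [KudlaRapoport2013] S. Kudla, M. Rapoport, *Special cycles on unitary Shimura varieties II: global theory*, J. reine
  angew. Math. 697 (2014) 91–157; arXiv:0912.3758v2, §13 pp. 48–51 (its sources for Prop. 13.1: Pappas, J. Alg. Geom. 9
  (2000) Thm. 4.5 = KR's [46]; Pappas–Rapoport III = [49] §5.c; Arzdorf = [2] Prop. 4.16).
-/

noncomputable section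

open NumberField CategoryTheory Matrix AlgebraicGeometry
open scoped nonZeroDivisors

namespace Literature.AlgebraicGeometry.ShimuraVarieties.KudlaRapoport2013.Sec13LevelStructures

open Literature.NumberTheory.Automorphic (unitaryGroupOfForm formCongr)
open Literature.NumberTheory.Automorphic.Liu2021.AppendixC (conj)
open Literature.AlgebraicGeometry.ShimuraVarieties.KudlaRapoport2013.Sec3ComplexUniformization
open Literature.AlgebraicGeometry.ShimuraVarieties.KudlaRapoport2013.Sec4RelationToShimuraVarieties (GU)

universe u v

/-! ## §13.1 (arXiv v2 pp. 48–49): special parahoric level structures at ramified primes -/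

section Types

variable (k : Type) [Field k] [NumberField k]

/-- `|Δ|`, the absolute discriminant of `k` («`p ∣ Δ`», «`Spec O_k[Δ⁻¹]`», §13.1 p. 48; `Δ` = the discriminant of the
imaginary-quadratic field `k`, §2), as a natural number (Mathlib `NumberField.discr`). [cite: KudlaRapoport2013, §13.1 (arXiv v2 p. 48)] -/
def absDisc : ℕ := (NumberField.discr k).natAbs

/-- **«the height of `ker λ` be equal to `∏_{p∣Δ} p^{t(p)}`»** (§13.1 p. 48), for a type function `t` on the prime divisors of
the discriminant of `k`. [cite: KudlaRapoport2013, §13.1 (arXiv v2 p. 48)] -/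
def typeHeight (t : ℕ → ℕ) : ℕ := ∏ p ∈ (absDisc k).primeFactors, p ^ t p

end Types

section Standing

variable (k : Type) [Field k] [NumberField k] [IsTotallyComplex k] [Algebra.IsQuadraticExtension ℚ k]

/-- **Standing data of §13**: the §3 datum (`k`, `τ`, `n ≥ 1`, `0 ≤ r ≤ n`, the complex-point carriers) extended by the TYPE
«For every `p ∣ Δ`, we fix an even integer `t(p)` with `0 ≤ t(p) ≤ n` (the type of `p`). We denote by `t` the function
`p ↦ t(p)` on the set of divisors of `Δ`» (§13.1 p. 48; REAL: a function on `ℕ` constrained at the prime divisors of `|Δ|`), and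
by the ⟨CARRIER⟩ type `MstarC` of complex points of `M(k, t; n−r, r)*` — the objects `(A, ι, λ)` over `Spec ℂ` of the variant
moduli problem (p. 48: «as in the definition of `M(k; n−r, r)^{naive}`, except that the condition that the polarization `λ` be
principal is replaced by …: `ker λ ⊂ A[Δ]`, … this action factors through the factor ring `∏_{p∣Δ} 𝔽_p` of `O_k/(Δ)`, and … the
height of `ker λ` be equal to `∏_{p∣Δ} p^{t(p)}`»; `M*` = the flat closure of the generic fibre, which has the same complex points),
whose groupoid structure the consumer supplies as `[Groupoid D.MstarC]`.  Nothing is asserted. [cite: KudlaRapoport2013, §13.1 (arXiv v2 p. 48)] -/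
structure Sec13Data : Type (u + 1) extends Sec3Data.{u} k where
  /-- the type function `p ↦ t(p)` (values at non-divisors of `Δ` are irrelevant). REAL. -/
  t : ℕ → ℕ
  /-- «an even integer `t(p)`» for every prime `p ∣ Δ`. -/
  t_even : ∀ p : ℕ, p.Prime → p ∣ absDisc k → Even (t p)
  /-- «`0 ≤ t(p) ≤ n`». -/
  t_le : ∀ p : ℕ, p.Prime → p ∣ absDisc k → t p ≤ n
  /-- ⟨CARRIER⟩ the objects of the groupoid `M(k, t; n−r, r)*(ℂ)`. -/
  MstarC : Type u

end Standing

section Sec131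

variable {k : Type} [Field k] [NumberField k] [IsTotallyComplex k] [Algebra.IsQuadraticExtension ℚ k]
variable {n : ℕ}

/-- ⟨CARRIER⟩ **The geometric properties asserted of `M(k, t; n−1, 1)*` in Proposition 13.1**, as `Prop`-valued PLACEHOLDER
fields on the consumer's model (Lean/Mathlib has no vocabulary for Cohen–Macaulay DM stacks, isolated rational singularities or
semi-stable reduction; each field's meaning is the quoted print and nothing else).  No closed fact of this file reduces to them.
[cite: KudlaRapoport2013, §13.1 Prop. 13.1 (arXiv v2 pp. 48–49)] -/
structure StarModelFacts : Type where
  /-- (i) «`M(k, t; n−1, 1)* = M(k; n−1, 1)`» (for `t = 0`). PLACEHOLDER. -/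
  eqPrincipalModel : Prop
  /-- (ii) at the prime `p`: «`M(k, t; n−1, 1)*` is Cohen-Macaulay, normal, and regular outside finitely many points». PLACEHOLDER. -/
  cmNormalRegularOutsideFinite : ℕ → Prop
  /-- (ii), `n ≥ 3`, at `p`: «the special fibers at such primes `p` are irreducible, reduced, normal and with isolated rational
  singularities». PLACEHOLDER. -/
  specialFibreIrredReducedNormalRationalSing : ℕ → Prop
  /-- (ii), `n = 2`, at `p`: «has semi-stable, but non-smooth, reduction at such primes». PLACEHOLDER. -/
  semistableNonSmoothReductionAt : ℕ → Prop
  /-- (iii)/(iv) at `p`: «is smooth at all primes `p ∣ Δ` with `t(p) = n`» (resp. `t(p) = n−1`). PLACEHOLDER. -/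
  smoothAt : ℕ → Prop

/-- **[KR2013, Proposition 13.1] AS PRINTED** (§13.1, arXiv v2 pp. 48–49), for the datum `D` and the consumer's ⟨CARRIER⟩ facts
`X` about its model of `M(k, t; n−1, 1)*`:

«Let `r = 1` and assume `2 ∤ Δ`. (i) If `t = 0`, then `M(k, t; n−1, 1)* = M(k; n−1, 1)`. (ii) At all primes `p ∣ Δ` with `t(p) = 0`,
`M(k, t; n−1, 1)*` is Cohen-Macaulay, normal, and regular outside finitely many points. If `n ≥ 3`, the special fibers at such
primes `p` are irreducible, reduced, normal and with isolated rational singularities. If `n = 2`, then `M(k, t; n−1, 1)*` has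
semi-stable, but non-smooth, reduction at such primes. (iii) If `n` is even, then `M(k, t; n−1, 1)*` is smooth at all primes `p ∣ Δ`
with `t(p) = n`. (iv) If `n` is odd, then `M(k, t; n−1, 1)*` is smooth at all primes `p ∣ Δ` with `t(p) = n−1`.»  (Proof, p. 49:
(i) = Pappas' Thm. 2.5 = [46] Thm. 4.5, (ii) loc. cit., (iii) = [49] §5.c, (iv) = [2] Prop. 4.16.)

TYPED: the hypotheses `r = 1`, `2 ∤ Δ` and the case split on `t(p)`, `n` are REAL; the conclusions are the PLACEHOLDER fields of `X`.
A consumer takes `(h : KR2013_13_1 D X)` for its own `D`, `X`. NO PROOF. [cite: KudlaRapoport2013, §13.1 Prop. 13.1 (arXiv v2 pp. 48–49)] -/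
def KR2013_13_1 (D : Sec13Data.{u} k) (X : StarModelFacts) : Prop :=
  D.r = 1 → ¬ 2 ∣ absDisc k →
    ((∀ p : ℕ, p.Prime → p ∣ absDisc k → D.t p = 0) → X.eqPrincipalModel) ∧
    (∀ p : ℕ, p.Prime → p ∣ absDisc k → D.t p = 0 →
      X.cmNormalRegularOutsideFinite p ∧ (3 ≤ D.n → X.specialFibreIrredReducedNormalRationalSing p) ∧
        (D.n = 2 → X.semistableNonSmoothReductionAt p)) ∧
    (Even D.n → ∀ p : ℕ, p.Prime → p ∣ absDisc k → D.t p = D.n → X.smoothAt p) ∧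
    (Odd D.n → ∀ p : ℕ, p.Prime → p ∣ absDisc k → D.t p = D.n - 1 → X.smoothAt p)

/-- **The dual `L^∨ = {x ∈ V | (x, L) ⊆ O_k}`** of an `O_k`-submodule `L ⊆ V = kⁿ` for the hermitian form with Gram matrix `J`
(Def. 13.2: «`L ⊂ L^∨ ⊂ Δ⁻¹L`»), as a subset of `V` (`IsSelfDualFor` of the §3 file is `L = L^∨`). [cite: KudlaRapoport2013, §13.1 Def. 13.2 (arXiv v2 p. 49)] -/
def dualSet (σ : k →+* k) (J : Matrix (Fin n) (Fin n) k) (L : Submodule (𝓞 k) (Fin n → k)) : Set (Fin n → k) :=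
  {x | ∀ y ∈ L, krForm σ J x y ∈ (algebraMap (𝓞 k) k).range}

/-- **[KR2013, Definition 13.2] AS PRINTED** (§13.1, arXiv v2 p. 49): «An `O_k`-module `L` equipped with a `k`-valued hermitian form
of signature `(n−r, r)` is called of type `t` if `L ⊂ L^∨ ⊂ Δ⁻¹L` and `L^∨/L ≃ ∏_{p∣Δ} 𝔽_p^{t(p)}`.»  (Footnote: «Hopefully, there will
be no confusion between this notion of type and the type of a `G₁^V`-genus which occurs in earlier sections.»)  TYPED for a hermitian
lattice `(J, L)` in coordinates (READING R0 of the §3 file; the signature clause is kept separate, see `IsTypeTHermLattice`):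
`L ⊆ L^∨`, `Δ L^∨ ⊆ L`, and — realising `L^∨` as an `O_k`-submodule `L'` with underlying set `dualSet` — an `O_k`-linear isomorphism
`L^∨/L ≃ ∏_{p∣Δ} 𝔽_p^{t(p)}`, where `𝔽_p = O_k/𝔭_p` for the prime `𝔭_p` of `O_k` with `𝔭_p² = (p)` (the unique, ramified, prime over
`p ∣ Δ`).  `Δ` enters through `|Δ| = absDisc k`. [cite: KudlaRapoport2013, §13.1 Def. 13.2 (arXiv v2 p. 49)] -/
def IsOfType (σ : k →+* k) (t : ℕ → ℕ) (X : LatticeDatum k n) : Prop :=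
  (∀ x ∈ X.L, x ∈ dualSet σ X.J X.L) ∧
    (∀ x ∈ dualSet σ X.J X.L, ((absDisc k : ℚ) : k) • x ∈ X.L) ∧
    ∃ (L' : Submodule (𝓞 k) (Fin n → k)) (𝔭 : ℕ → Ideal (𝓞 k)),
      (L' : Set (Fin n → k)) = dualSet σ X.J X.L ∧
      (∀ p ∈ (absDisc k).primeFactors, (𝔭 p).IsPrime ∧ 𝔭 p ^ 2 = Ideal.span {((p : ℤ) : 𝓞 k)}) ∧
      Nonempty ((L' ⧸ X.L.comap L'.subtype) ≃ₗ[𝓞 k]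
        ((p : (absDisc k).primeFactors) → Fin (t p) → 𝓞 k ⧸ 𝔭 p))

/-- **`𝓛_{(n−r,r)}(k, t)`, «the set of isomorphism classes of hermitian `O_k`-modules of signature `(n−r, r)` and type `t`»**
(§13.1 p. 49), as the defining predicate on `LatticeDatum`s (isomorphism = transport by `GL_n(k)`, `LatticeDatum.Moves`):
`J` hermitian of signature `(n−r, r)` at `τ`, `L` a full `O_k`-lattice of type `t`. [cite: KudlaRapoport2013, §13.1 (arXiv v2 p. 49)] -/
def IsTypeTHermLattice (σ : k →+* k) (τ : k →+* ℂ) (r : ℕ) (t : ℕ → ℕ) (X : LatticeDatum k n) : Prop :=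
  IsHermitianFor σ X.J ∧ HasSignatureAt τ X.J r ∧ IsFullLattice X.L ∧ IsOfType σ t X

/-- **[KR2013 §13.1, after Def. 13.2] CLOSED** (arXiv v2 p. 49): «In particular, an `O_k`-module of type `t = 0` is a self-dual
hermitian `O_k`-module.»  TYPED (and conversely): for a hermitian full lattice `(J, L)`, type `t = 0` iff self-dual.
[cite: KudlaRapoport2013, §13.1 (arXiv v2 p. 49)] -/
def KR2013_13_2_typeZero : Prop :=
  ∀ (k : Type) [Field k] [NumberField k] [IsTotallyComplex k] [Algebra.IsQuadraticExtension ℚ k] (n : ℕ)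
    (X : LatticeDatum k n), IsHermitianFor (conj ℚ k : k →+* k) X.J → IsFullLattice X.L →
    (IsOfType (conj ℚ k : k →+* k) (fun _ => 0) X ↔ IsSelfDualFor (conj ℚ k : k →+* k) X.J X.L)

/-- **[KR2013 §13.1, after Def. 13.2] CLOSED** (arXiv v2 p. 49): «We note that for any `O_k`-module of type `t`, the hermitian
space `V = L ⊗ ℚ` is relevant. Indeed, to check the existence of a self-dual lattice in `V`, it suffices to check this locally at
any inert prime `p`. But for such `p` a self-dual lattice in `V_p` is given by `L ⊗ ℤ_p = L^∨ ⊗ ℤ_p`.»  TYPED (the claim): if `(J, L)`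
is a hermitian full lattice of type `t` (for a type function `t` as in §13.1), then `V = (kⁿ, J)` contains a self-dual full
`O_k`-lattice («relevant», §2.4). [cite: KudlaRapoport2013, §13.1 (arXiv v2 p. 49)] -/
def KR2013_13_2_relevant : Prop :=
  ∀ (k : Type) [Field k] [NumberField k] [IsTotallyComplex k] [Algebra.IsQuadraticExtension ℚ k] (n : ℕ) (t : ℕ → ℕ),
    (∀ p : ℕ, p.Prime → p ∣ absDisc k → Even (t p) ∧ t p ≤ n) →
    ∀ X : LatticeDatum k n, IsHermitianFor (conj ℚ k : k →+* k) X.J → IsFullLattice X.L →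
      IsOfType (conj ℚ k : k →+* k) t X →
      ∃ L' : Submodule (𝓞 k) (Fin n → k), IsFullLattice L' ∧ IsSelfDualFor (conj ℚ k : k →+* k) X.J L'

/-- **[KR2013 §13.1, the existence of lattices of type `t` — its finite-field step] CLOSED** (arXiv v2 p. 49): «if `2 ∤ Δ`, lattices
of type `t` always exist in a given relevant hermitian space `V`, except in the case when `n` is even and `t(p) = n` for some `p ∣ Δ`
with `inv_p(V) = −1`. Indeed, this is a local question at primes `p` dividing `Δ`. Fix a self-dual lattice `Λ` in `V_p`. Then, up to
conjugacy under the unitary group `U(V_p)`, the lattices `L` in `V_p` with `L ⊂ L^∨ ⊂ π⁻¹L` such that `L^∨/L ≃ 𝔽_p^{t(p)}` correspond to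
the totally isotropic subspaces of `Λ/πΛ` of dimension `t(p)/2` with respect to the non-degenerate symmetric form induced by the
hermitian form. Such subspaces always exist except in the case when `n` is even and `t(p) = n`, in which case they exist if and only
if `inv_p(V) = 1`.»  TYPED: the clause «such subspaces always exist» — for an odd prime `p`, a non-degenerate quadratic space `W` of
dimension `n` over `𝔽_p` (Mathlib `QuadraticForm`, non-degeneracy of the polar form) and an even `t ≤ n` with `t ≠ n`, there is a
totally isotropic subspace of dimension `t/2`.  The global existence statement and the exceptional clause («iff `inv_p(V) = 1`»,
`inv_p(V) = (det V, Δ)_p`) are RECORDED, not typed (no Hilbert symbol / `p`-adic hermitian lattices in the tree).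
[cite: KudlaRapoport2013, §13.1 (arXiv v2 p. 49)] -/
def KR2013_13_2_isotropic : Prop :=
  ∀ (p : ℕ) [Fact p.Prime], p ≠ 2 → ∀ (n t : ℕ) (Q : QuadraticForm (ZMod p) (Fin n → ZMod p)),
    (QuadraticMap.polarBilin Q).Nondegenerate → Even t → t ≤ n → t ≠ n →
      ∃ U : Submodule (ZMod p) (Fin n → ZMod p), Module.finrank (ZMod p) U = t / 2 ∧ ∀ x ∈ U, Q x = 0

/-- The objects of the transport groupoid `∐_{L ∈ 𝓛_{(n−r,r)}(k,t)} [Γ_L∖D(L)]` of Proposition 13.3 (READING R2 of the §3 file): a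
hermitian lattice `(J, L)` of signature `(n−r, r)` and type `t`, with a point `z ∈ D(L)`. [cite: KudlaRapoport2013, §13.1 Prop. 13.3 (arXiv v2 p. 49)] -/
structure TypedLatticePoint (D : Sec13Data.{u} k) : Type where
  /-- the hermitian lattice `(J, L)` of type `t` -/
  X : LatticeDatum k D.n
  /-- the negative `r`-plane `z ∈ D(L)` -/
  z : Submodule ℂ (Fin D.n → ℂ)
  isLattice : IsTypeTHermLattice (conj ℚ k : k →+* k) D.τ D.r D.t X
  mem_negPlanes : z ∈ negPlanes D.r (X.J.map D.τ)

/-- `g ∈ GL_n(k)` carries `(J, L, z)` to `(J', L', z')` (isometry, `g L = L'`, `g z = z'`); for fixed `(J, L)` these are the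
`γ ∈ Γ_L` with `γ z = z'`. [cite: KudlaRapoport2013, §13.1 Prop. 13.3 (arXiv v2 p. 49)] -/
def TypedLatticePoint.Moves {D : Sec13Data.{u} k} (g : GL (Fin D.n) k) (P Q : TypedLatticePoint D) : Prop :=
  LatticeDatum.Moves g P.X Q.X ∧ Q.z = planeImage D.τ g P.z

/-- **[KR2013, Proposition 13.3] AS PRINTED** (§13.1, arXiv v2 p. 49), for the datum `D` and the consumer's groupoid structure on
`D.MstarC = M(k, t; n−r, r)*(ℂ)`: «There is an isomorphism of orbifolds `M(k, t; n−r, r)*(ℂ) ≅ ∐_L [Γ_L∖D(L)]`, where `L` runs over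
`𝓛_{(n−r,r)}(k, t)`.» («the following analogue of Proposition 3.1».)  TYPED (READINGS R0–R2 of the §3 file): the groupoid
`M(k, t; n−r, r)*(ℂ)` is equivalent to the transport groupoid of `TypedLatticePoint D` under `GL_n(k)`.  A consumer takes
`(h : KR2013_13_3 D)` for its own `D`. NO PROOF. [cite: KudlaRapoport2013, §13.1 Prop. 13.3 (arXiv v2 p. 49)] -/
def KR2013_13_3 (D : Sec13Data.{u} k) [Groupoid.{v} D.MstarC] : Prop :=
  IsGroupoidEquivOfAction D.MstarC (G := GL (Fin D.n) k) (TypedLatticePoint.Moves (D := D))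

/-- Isomorphism classes of hermitian lattices in `kⁿ` satisfying a predicate `P` (transport by `GL_n(k)`), as a quotient type —
used to state Remark 13.4 («set of isomorphism classes»). [cite: KudlaRapoport2013, §13.1 (arXiv v2 p. 49)] -/
def LatticeClasses (k : Type) [Field k] [NumberField k] [IsTotallyComplex k] [Algebra.IsQuadraticExtension ℚ k] (n : ℕ)
    (P : LatticeDatum k n → Prop) : Type :=
  Quot fun X Y : {X : LatticeDatum k n // P X} => ∃ g : GL (Fin n) k, LatticeDatum.Moves g X.1 Y.1

/-- **[KR2013, Remark 13.4] REMARK-STATEMENT, AS PRINTED — asserted in loc. cit. without proof («by our remarks above»);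
literal reading NOT certified; not a certified named fact of this file, DO NOT CONSUME as a hypothesis `(h : KR2013_13_4)`;
certified content of the «remarks above»: `KR2013_13_2_isotropic` (local type ↔ isotropic-subspace correspondence),
`KR2013_13_2_relevant`** (ED. 2, squad ruling R-10; ED. 1 had bannered it CLOSED).  (§13.1, arXiv v2 p. 49): «By our remarks
above, the set `𝓛_{(n−r,r)}(k, t)` is either empty or is in bijective correspondence with `𝓛_{(n−r,r)}(k)`, provided that
`2 ∤ Δ`.»  TYPED literally: for `2 ∤ Δ`, a complex embedding `τ`, `0 ≤ r ≤ n` and a type function `t`, the set of isomorphism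
classes of hermitian lattices of signature `(n−r, r)` and type `t` is empty or in bijection with the set of isomorphism classes
of self-dual hermitian lattices of signature `(n−r, r)`.  DOUBT ON THE LITERAL READING (QA-R6-1, T-ref6 2026-09-02): KR's
remarks give a correspondence of LOCAL types / genera and existence, not of global class SETS; for `k = ℚ(√−15)`, `n = 2`,
`r = 1`, `t(3) = 2`, `t(5) = 0` a class-number count via strong approximation for `SU(V)` gives `|𝓛_{(1,1)}(k, t)| = h¹ ≠ 0`
against `|𝓛_{(1,1)}(k)| = 2h¹`, so the disjunction below would fail there (modulo Jacobowitz's local classification and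
Shimura's class-number formula, neither in the tree); for `0 < t(p) < n − 1` the two genera even have different masses.  Kept
under its ED. 1 name and body as the record of the printed sentence. [cite: KudlaRapoport2013, §13.1 Rem. 13.4 (arXiv v2 p. 49)] -/
def KR2013_13_4 : Prop :=
  ∀ (k : Type) [Field k] [NumberField k] [IsTotallyComplex k] [Algebra.IsQuadraticExtension ℚ k] (τ : k →+* ℂ)
    (n r : ℕ) (t : ℕ → ℕ), ¬ 2 ∣ absDisc k → r ≤ n → (∀ p : ℕ, p.Prime → p ∣ absDisc k → Even (t p) ∧ t p ≤ n) →
    IsEmpty {X : LatticeDatum k n // IsTypeTHermLattice (conj ℚ k : k →+* k) τ r t X} ∨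
      Nonempty (LatticeClasses k n (IsTypeTHermLattice (conj ℚ k : k →+* k) τ r t) ≃
        LatticeClasses k n (IsSelfDualHermLattice (conj ℚ k : k →+* k) τ r))

end Sec131

/-! ## §13.2 (arXiv v2 pp. 50–51): level structures at unramified primes -/

section Sec132

variable {k : Type} [Field k] [NumberField k] [IsTotallyComplex k] [Algebra.IsQuadraticExtension ℚ k]
variable {n : ℕ}

/-- **The standard hermitian form `h` on `(O_k/N O_k)ⁿ`** (Def. 13.5, p. 50: «given in terms of the canonical basis by
`h(e_i, e_{n−j+1}) = δ_{ij}`, `∀ i, j = 1, …, n`»), as its Gram matrix over any semiring: the ANTI-DIAGONAL unit matrix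
(`(e_i, e_l) = 1` iff `i + l = n + 1` in KR's `1`-based indexing). [cite: KudlaRapoport2013, §13.2 Def. 13.5 (arXiv v2 p. 50)] -/
def stdHermMatrix (n : ℕ) (R : Type*) [Zero R] [One R] : Matrix (Fin n) (Fin n) R :=
  Matrix.of fun i j => if (i : ℕ) + (j : ℕ) + 1 = n then 1 else 0

/-- ⟨CARRIER⟩ **The data of Definition 13.5** for the consumer's object `(A, ι, λ)` of `M(k; n−r, r)(S)` over its `O_k`-scheme `S`
(the §2 object carriers are the squad's `Sec2Defs`, not re-declared): the posited predicate «`η` is a level-`N` structure on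
`(A, ι, λ)`» on a posited type of candidate isomorphisms `A[N] ⥲ (O_k/N O_k)ⁿ_S`, and the REAL predicate «`N` is invertible on `S`».
PLACEHOLDERS (meaning = the quoted print). [cite: KudlaRapoport2013, §13.2 Def. 13.5 (arXiv v2 p. 50)] -/
structure LevelNData : Type (u + 1) where
  /-- ⟨CARRIER⟩ for each `N`, the `O_k`-linear isomorphisms of finite group schemes `A[N] ⥲ (O_k/N O_k)ⁿ_S` (candidates). -/
  Cand : ℕ → Type u
  /-- ⟨CARRIER⟩ «a level `N`-structure»: a candidate «compatible with the hermitian form associated to the Riemann form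
  corresponding to `λ` on the LHS and the standard hermitian form on the RHS, up to a scalar in `(ℤ/Nℤ)^×`». PLACEHOLDER. -/
  IsLevelNStructure : (N : ℕ) → Cand N → Prop
  /-- «`N` is invertible on `S`» (for the consumer's base `S`). PLACEHOLDER for `IsUnit (N : Γ(S, 𝒪_S))`. -/
  InvertibleOnBase : ℕ → Prop

/-- **[KR2013, Definition 13.5] AS PRINTED** (§13.2, arXiv v2 p. 50), for the consumer's ⟨CARRIER⟩ level data `X`:

«Let `N` be an odd positive integer prime to `Δ`. A level `N`-structure on an object `(A, ι, λ)` of `M(k; n−r, r)(S)` is an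
`O_k`-linear isomorphism of finite group schemes `A[N] ⥲ (O_k/N O_k)ⁿ_S`, compatible with the hermitian form associated to the
Riemann form corresponding to `λ` on the LHS and the standard hermitian form on the RHS, up to a scalar in `(ℤ/Nℤ)^×`.»  Followed
by: «Here the standard hermitian form `h` on `(O_k/N O_k)ⁿ` … is given … by `h(e_i, e_{n−j+1}) = δ_{ij}`» (`stdHermMatrix`), «Note that
a level `N`-structure can only exist if `N` is invertible on `S`. The compatibility condition is independent of the choice of
trivialization of the `N`-th roots of unity …».

TYPED: the REAL hypotheses on `N` (odd, positive, prime to `Δ`) and the printed consequence «can only exist if `N` is invertible on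
`S`»: `IsLevelNStructure N η → InvertibleOnBase N`.  The definition proper is the PLACEHOLDER `X.IsLevelNStructure`.  A consumer takes
`(h : KR2013_13_5 X)` for its own `X`. NO PROOF. [cite: KudlaRapoport2013, §13.2 Def. 13.5 (arXiv v2 p. 50)] -/
def KR2013_13_5 (X : LevelNData.{u}) : Prop :=
  ∀ N : ℕ, Odd N → 0 < N → N.Coprime (absDisc k) → ∀ η : X.Cand N, X.IsLevelNStructure N η → X.InvertibleOnBase N

/-- **[KR2013 §13.2, after Def. 13.5] CLOSED** (arXiv v2 p. 50): «We also note that if `L` is a self-dual `O_k`-module, then `L/NL` is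
isomorphic to `(O_k/N O_k)ⁿ` with the standard form.»  TYPED inside `V = kⁿ` (READING R0 of the §3 file): for `N` odd, positive and
prime to `Δ` and `(J, L)` a self-dual hermitian full lattice, there are `e₁, …, e_n ∈ L` such that (a) `L = Σ_i O_k e_i + N L`,
(b) `Σ a_i e_i ∈ N L` only if all `a_i ∈ N O_k` (so `ē_i` is an `O_k/N`-basis of `L/NL`), and (c) `(e_i, e_j) ≡ h(ē_i, ē_j) (mod N O_k)`,
`h` the standard form: `(e_i, e_j) − [i + j = n + 1] ∈ N O_k`. [cite: KudlaRapoport2013, §13.2 (arXiv v2 p. 50)] -/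
def KR2013_13_5_reduction : Prop :=
  ∀ (k : Type) [Field k] [NumberField k] [IsTotallyComplex k] [Algebra.IsQuadraticExtension ℚ k] (n N : ℕ),
    Odd N → 0 < N → N.Coprime (absDisc k) →
    ∀ X : LatticeDatum k n, IsHermitianFor (conj ℚ k : k →+* k) X.J → IsFullLattice X.L →
      IsSelfDualFor (conj ℚ k : k →+* k) X.J X.L →
      ∃ e : Fin n → Fin n → k, (∀ i, e i ∈ X.L) ∧
        Submodule.span (𝓞 k) (Set.range e) ⊔ (Ideal.span {((N : ℤ) : 𝓞 k)} • X.L) = X.L ∧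
        (∀ a : Fin n → 𝓞 k, (∑ i, (a i : k) • e i) ∈ Ideal.span {((N : ℤ) : 𝓞 k)} • X.L →
          ∀ i, a i ∈ Ideal.span {((N : ℤ) : 𝓞 k)}) ∧
        ∀ i j, ∃ c : 𝓞 k, c ∈ Ideal.span {((N : ℤ) : 𝓞 k)} ∧
          krForm (conj ℚ k : k →+* k) X.J (e i) (e j) = stdHermMatrix n k i j + (c : k)

/-- **[KR2013 §13.2, after Def. 13.5] AS PRINTED** (arXiv v2 p. 50), for the datum `D`, an integer `N ≥ 3` and the consumer's
⟨CARRIER⟩ SCHEME model `M` of `M(k; n−r, r)_{(N)} ×_{Spec O_k} Spec O_k[(NΔ)⁻¹]` with its structure morphism `f` (REAL base: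
`O_k[(NΔ)⁻¹]` = Mathlib `Localization.Away`): «We obtain a Deligne-Mumford stack `M(k; n−r, r)_{(N)}` over `M(k; n−r, r)[N⁻¹]` which
parametrizes collections `(A, ι, λ, η)` where `η` is a level `N`-structure. It is smooth of relative dimension `(n−r)r` over
`Spec O_k[(NΔ)⁻¹]`. Note that if `N ≥ 3`, then, by Serre's Lemma, `M(k; n−r, r)_{(N)}` is a scheme.»  TYPED (for `N ≥ 3`, odd, prime to
`Δ`, where the stack IS a scheme): `f` is smooth of relative dimension `(n−r)r` (Mathlib `SmoothOfRelativeDimension`).  That `M` is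
the moduli scheme is the carrier's meaning (docstring), as for every ⟨CARRIER⟩.  NO PROOF. [cite: KudlaRapoport2013, §13.2 (arXiv v2 p. 50)] -/
def KR2013_13_5_model (D : Sec13Data.{u} k) (N : ℕ) (M : Scheme.{0})
    (f : M ⟶ Spec (.of (Localization.Away (((N * absDisc k : ℕ) : ℤ) : 𝓞 k)))) : Prop :=
  3 ≤ N → Odd N → N.Coprime (absDisc k) → SmoothOfRelativeDimension ((D.n - D.r) * D.r) f

/-- **`GU((O_k/N O_k)ⁿ)`** (Rem. 13.6, p. 50: «a subgroup `K̄` of `GU((O_k/N O_k)ⁿ)`»; p. 50: «`Γ(1) = GU(O_kⁿ ⊗ ℤ_N)`»): the similitude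
group of the standard form `stdHermMatrix` over the finite ring `R = O_k/N O_k` with the involution `σ_N` induced by `σ` — the squad's
★ `GU σ_N (stdHermMatrix n R)` (graph of the multiplier).  `σ_N` is a parameter (the consumer's reduction of `σ` mod `N`).
[cite: KudlaRapoport2013, §13.2 Rem. 13.6 (arXiv v2 p. 50)] -/
def levelGroupModN {R : Type*} [CommRing R] (σN : R →+* R) (n : ℕ) : Set (GL (Fin n) R × Rˣ) :=
  GU σN (stdHermMatrix n R)

/-- **The subgroup `K̄` «preserving the standard flag spanned by `e₁, e₂, …, e_n`»** (Rem. 13.6, p. 50): the elements of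
`GU((O_k/N O_k)ⁿ)` whose matrix is upper triangular (Mathlib `Matrix.BlockTriangular · id`).
[cite: KudlaRapoport2013, §13.2 Rem. 13.6 (arXiv v2 p. 50)] -/
def stdFlagStabilizer {R : Type*} [CommRing R] (σN : R →+* R) (n : ℕ) : Set (GL (Fin n) R × Rˣ) :=
  {p | p ∈ levelGroupModN σN n ∧ (p.1 : Matrix (Fin n) (Fin n) R).BlockTriangular id}

/-- ⟨CARRIER⟩ **The data of Remark 13.6** for the consumer's object over its base: candidate isomorphisms `A[N] ⥲ (O_k/N O_k)ⁿ_S`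
(as in `LevelNData`), with the ⟨CARRIER⟩ action of `GU((O_k/N O_k)ⁿ)` on them by composition and the posited predicate «level
`K̄`-structure» (an isomorphism «given modulo `K̄`»); plus ⟨CARRIER⟩ «complete flags of primitive `O_k`-submodules in `A[N]`, self-dual
for the Riemann form» for the example.  PLACEHOLDERS. [cite: KudlaRapoport2013, §13.2 Rem. 13.6 (arXiv v2 p. 50)] -/
structure LevelKbarData (R : Type) [CommRing R] (σN : R →+* R) (n N : ℕ) : Type (u + 1) where
  /-- ⟨CARRIER⟩ candidate isomorphisms `A[N] ⥲ (O_k/N O_k)ⁿ_S`. -/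
  Cand : Type u
  /-- ⟨CARRIER⟩ composition of a candidate with an element of `GU((O_k/N O_k)ⁿ)` acting on the target. -/
  act : (GL (Fin n) R × Rˣ) → Cand → Cand
  /-- ⟨CARRIER⟩ «a level `K̄`-structure», for `K̄ ⊆ GU((O_k/N O_k)ⁿ)`: a class of candidates modulo `K̄`. PLACEHOLDER. -/
  IsLevelStructure : Set (GL (Fin n) R × Rˣ) → Set Cand → Prop
  /-- ⟨CARRIER⟩ complete flags of primitive `O_k`-submodules in `A[N]`, self-dual for the Riemann form. -/
  SelfDualFlag : Type u
  /-- ⟨CARRIER⟩ the flag in `A[N]` pulled back from the standard flag `⟨e₁⟩ ⊂ ⟨e₁, e₂⟩ ⊂ …` along a candidate. -/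
  flagOf : Cand → SelfDualFlag

/-- **[KR2013, Remark 13.6] AS PRINTED** (§13.2, arXiv v2 p. 50), for `R = O_k/N O_k` with involution `σ_N` and the consumer's ⟨CARRIER⟩
data `X`: «A variant of the preceding definition arises from a subgroup `K̄` of `GU((O_k/N O_k)ⁿ)`, defining a level `K̄`-structure to
be an isomorphism between `A[N]` and `(O_k/N O_k)ⁿ_S`, given modulo `K̄`. In this way we obtain a Deligne-Mumford stack
`M(k; n−r, r)_{(N),K̄}` over `Spec O_k[N⁻¹]`. For instance, if `K̄` is the subgroup preserving the standard flag spanned by `e₁, e₂, …, e_n`,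
then a level `K̄`-structure corresponds to a complete flag of primitive `O_k`-submodules in `A[N]`, which is self-dual for the Riemann
form.»  TYPED: (a) a level `K̄`-structure, `K̄ ⊆ GU((O_k/N O_k)ⁿ)` (`levelGroupModN`), is a `K̄`-orbit of candidates: `X.IsLevelStructure K̄ C`
only for `C` of the form `{κ · η | κ ∈ K̄}`; (b) for `K̄ = stdFlagStabilizer`, «corresponds to» = `η ↦ flagOf η` induces a BIJECTION
between level `K̄`-structures and self-dual complete flags.  The DM-stack sentence is RECORDED.  A consumer takes `(h : KR2013_13_6 X)`.
NO PROOF. [cite: KudlaRapoport2013, §13.2 Rem. 13.6 (arXiv v2 p. 50)] -/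
def KR2013_13_6 {R : Type} [CommRing R] {σN : R →+* R} {n N : ℕ} (X : LevelKbarData.{u} R σN n N) : Prop :=
  (∀ (Kbar : Set (GL (Fin n) R × Rˣ)) (C : Set X.Cand), Kbar ⊆ levelGroupModN σN n → X.IsLevelStructure Kbar C →
      ∃ η : X.Cand, C = {η' | ∃ κ ∈ Kbar, η' = X.act κ η}) ∧
    ∃ Φ : {C : Set X.Cand // X.IsLevelStructure (stdFlagStabilizer σN n) C} → X.SelfDualFlag,
      Function.Bijective Φ ∧ ∀ (C : {C : Set X.Cand // X.IsLevelStructure (stdFlagStabilizer σN n) C}) (η : X.Cand),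
        η ∈ C.1 → Φ C = X.flagOf η

end Sec132

end Literature.AlgebraicGeometry.ShimuraVarieties.KudlaRapoport2013.Sec13LevelStructures

end
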